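import Literature.MathematicalPhysics.KineticTheory.PalmMismatchRingTheorems
import HarnessLib

/-!
# Palm-mismatch collision operator, IV: the linearised field is the derivative of the collision field

Topic `Literature/MathematicalPhysics/KineticTheory`; third sequel of `PalmMismatchRing.lean`
(definition request `defn-palmMismatchOperator`, route CollisionNoise). This file certifies in Lean the
step of the author's derivation that was previously only checked numerically: `palmMismatchLin` (the
closed-form first-order operator) IS the derivative at the Gibbs point of the nonlinear Palm collision
field `palmCollisionField` (Rice weights × Palm-averaged increments, per unit Gibbs rate) in every
flow-invariant symmetric direction.

## Contents (all proved)

* `exchangeIncrement_eq_smul_vecMulVec`: `R_xδCR_xᵀ - δC = T(m'(-ℓ_ṙ*)ᵀ + (-ℓ_ṙ*)m'ᵀ)`, `m' = palmKick`.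
* `palmMismatchIncrement_eq` (structure of the Palm increment): for symmetric `C` with
  `Cov_C(ṙ_x, r_x) = 0` and `λ₂ ≠ 0`, `Δ_x(C) = λ₂(m(-ℓ_ṙ*)ᵀ + (-ℓ_ṙ*)mᵀ) + √(πλ₂/2)(u mᵀ + m uᵀ)` with
  `m = 2w - ℓ_ṙ*` (`R_x u = u`, `R_x w = w - ℓ_ṙ*`); `Cov(ṙ_x, r_x) = 0` for every flow-invariant
  symmetric matrix (`velCovector_dotProduct_mulVec_stretchCovector_eq_zero`).
* Gibbs data: `stretchVar_gibbsCov_pos`, `riceRate_gibbsCov_eq`, `riceRate_gibbsCov_pos`; calculus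
  along `s ↦ G_T + sδC`: `hasDerivAt_palmM_apply` (`m' = palmKick`), differentiability of `u`,
  `√(πλ₂/2)`, the Rice rate; `hasDerivAt_palmMismatchIncrement_apply` (one bond), and the **main
  statement** `hasDerivAt_palmCollisionField_apply`: for `ω₂, T > 0` and flow-invariant symmetric
  `δC`, `HasDerivAt (s ↦ palmCollisionField (G_T + sδC) i j) (palmMismatchLin δC i j) 0`.
With `trace_mul_palmMismatchLin` (`PalmMismatchRingTheorems.lean`) this closes the chain
request ↦ `𝒩_T` ↦ `D𝒩_T(G_T) = palmMismatchLin` ↦ flow-invariant matrix elements `= 2 ×` exchange.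
-/

noncomputable section

open Matrix Finset

namespace Literature.MathematicalPhysics.KineticTheory.PalmMismatch

variable {n : ℕ} [NeZero n]

/-! ### §1. Algebra: the exchange identity and the structure of the Palm increment -/

/-- **Exchange identity**: for symmetric `δC` and `T ≠ 0`,
`R_x δC R_xᵀ - δC = T (m'(-ℓ_ṙ*)ᵀ + (-ℓ_ṙ*) m'ᵀ)` with `m' = palmKick T x δC`. [folklore] -/
theorem exchangeIncrement_eq_smul_vecMulVec {T : ℝ} (hT : T ≠ 0) (x : ZMod n)
    {D : Matrix (PhaseIdx n) (PhaseIdx n) ℝ} (hDs : Dᵀ = D) :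
    exchangeIncrement x D =
      T • (vecMulVec (palmKick T x D) (-velCovector x) + vecMulVec (-velCovector x) (palmKick T x D)) := by
  unfold exchangeIncrement palmKick exchangeMatrix
  set ℓ := velCovector x
  set c := ℓ ⬝ᵥ D *ᵥ ℓ
  have hv : ℓ ᵥ* D = D *ᵥ ℓ := by rw [← mulVec_transpose, hDs]
  -- left-hand side
  have hL : (1 - vecMulVec ℓ ℓ) * D * (1 - vecMulVec ℓ ℓ)ᵀ - D =
      -(vecMulVec ℓ (D *ᵥ ℓ)) - vecMulVec (D *ᵥ ℓ) ℓ + c • vecMulVec ℓ ℓ := by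
    rw [transpose_sub, transpose_one, transpose_vecMulVec, Matrix.sub_mul, Matrix.one_mul,
      vecMulVec_mul, hv, Matrix.mul_sub, Matrix.mul_one, Matrix.sub_mul, mul_vecMulVec,
      vecMulVec_mul_vecMulVec, dotProduct_comm, vecMulVec_smul]
    abel
  rw [hL]
  -- right-hand side
  simp only [smul_sub, vecMulVec_sub, sub_vecMulVec, vecMulVec_neg, neg_vecMulVec, vecMulVec_smul,
    smul_vecMulVec, smul_add, smul_neg, smul_smul, mul_inv_cancel₀ hT, one_smul, neg_sub]
  rw [show T * (T⁻¹ * (c / 2)) = c / 2 by field_simp]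
  rw [show -vecMulVec ℓ (D *ᵥ ℓ) - vecMulVec (D *ᵥ ℓ) ℓ + c • vecMulVec ℓ ℓ =
      -vecMulVec ℓ (D *ᵥ ℓ) - vecMulVec (D *ᵥ ℓ) ℓ + ((c / 2) • vecMulVec ℓ ℓ + (c / 2) • vecMulVec ℓ ℓ)
      by rw [← add_smul, add_halves]]
  abel

/-- **Structure of the Palm increment.** For symmetric `C` with `Cov_C(ṙ_x, r_x) = 0` and `λ₂ ≠ 0`:
`Δ_x(C) = λ₂ (m(-ℓ)ᵀ + (-ℓ)mᵀ) + √(πλ₂/2)(u mᵀ + m uᵀ)`, `m = 2w - ℓ_ṙ*` (so `R_x u = u`,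
`R_x w = w - ℓ_ṙ*`, `R_x C R_xᵀ = C - λ₂(ℓw ᵀ+ wℓᵀ) + λ₂ ℓℓᵀ`). [folklore] -/
theorem palmMismatchIncrement_eq {C : Matrix (PhaseIdx n) (PhaseIdx n) ℝ} (hCs : Cᵀ = C) (x : ZMod n)
    (h0 : velCovector x ⬝ᵥ C *ᵥ stretchCovector x = 0) (h2 : velVar C x ≠ 0) :
    palmMismatchIncrement C x =
      velVar C x • (vecMulVec (((2 : ℝ) • palmDrift C x - velCovector x)) (-velCovector x) + vecMulVec (-velCovector x) (((2 : ℝ) • palmDrift C x - velCovector x)))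
      + rayleighMean (velVar C x) •
        (vecMulVec (palmBump C x) (((2 : ℝ) • palmDrift C x - velCovector x)) + vecMulVec (((2 : ℝ) • palmDrift C x - velCovector x)) (palmBump C x)) := by
  unfold palmMismatchIncrement palmSecondMoment
  set ℓ := velCovector x
  set R := exchangeMatrix x
  set u := palmBump C x
  set w := palmDrift C x with hw
  have hℓu : ℓ ⬝ᵥ u = 0 := by
    simp only [u, palmBump, dotProduct_smul, h0, smul_zero]
  have hℓw : ℓ ⬝ᵥ w = 1 := by
    simp only [w, palmDrift, dotProduct_smul, smul_eq_mul]
    exact inv_mul_cancel₀ h2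
  have hCℓ : C *ᵥ ℓ = velVar C x • w := by
    rw [hw, palmDrift, smul_smul, mul_inv_cancel₀ h2, one_smul]
  have hv : ℓ ᵥ* C = velVar C x • w := by rw [← mulVec_transpose, hCs, hCℓ]
  have hRu : R *ᵥ u = u := by rw [exchangeMatrix_mulVec, hℓu, zero_smul, sub_zero]
  have hRw : R *ᵥ w = w - ℓ := by rw [exchangeMatrix_mulVec, hℓw, one_smul]
  have hRt : Rᵀ = R := by simp [R, exchangeMatrix, transpose_sub]
  have hRC : R * C * Rᵀ =
      C - velVar C x • (vecMulVec ℓ w + vecMulVec w ℓ) + velVar C x • vecMulVec ℓ ℓ := by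
    rw [hRt]
    show (1 - vecMulVec ℓ ℓ) * C * (1 - vecMulVec ℓ ℓ) = _
    rw [Matrix.sub_mul, Matrix.one_mul, vecMulVec_mul, hv, vecMulVec_smul, Matrix.mul_sub,
      Matrix.mul_one, Matrix.sub_mul, mul_vecMulVec, hCℓ, smul_vecMulVec, Matrix.smul_mul,
      vecMulVec_mul_vecMulVec, dotProduct_comm, hℓw, one_smul, smul_add]
    abel
  simp only [Matrix.mul_add, Matrix.add_mul, Matrix.mul_smul, Matrix.smul_mul,
    mul_vecMulVec_mul_transpose, hRu, hRw, hRC]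
  simp only [vecMulVec_sub, sub_vecMulVec, vecMulVec_neg, neg_vecMulVec,
    vecMulVec_smul, smul_vecMulVec, smul_add, smul_sub, smul_neg, one_mul, neg_mul, neg_smul]
  module

/-- `Cov(ṙ_x, r_x) = 0` for every flow-invariant symmetric matrix on the ring. [folklore] -/
theorem velCovector_dotProduct_mulVec_stretchCovector_eq_zero {ω₂ : ℝ}
    {C : Matrix (PhaseIdx n) (PhaseIdx n) ℝ} (hC : IsFlowInvariant (flowMatrix n ω₂) C) (hCs : Cᵀ = C)
    (x : ZMod n) : velCovector x ⬝ᵥ C *ᵥ stretchCovector x = 0 := by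
  obtain ⟨c21, -, -, -⟩ := IsFlowInvariant.blocks (forceMatrix_transpose ω₂) (by simpa [flowMatrix] using hC)
  have h12t : (C.toBlocks₁₂)ᵀ = -C.toBlocks₁₂ :=
    (congrArg Matrix.toBlocks₂₁ hCs : (C.toBlocks₁₂)ᵀ = C.toBlocks₂₁).trans c21
  have h21t : (C.toBlocks₂₁)ᵀ = -C.toBlocks₂₁ := by
    rw [c21, transpose_neg, h12t, neg_neg]
  unfold velCovector stretchCovector
  conv_lhs => rw [← fromBlocks_toBlocks C, fromBlocks_mulVec]
  simp only [Sum.elim_comp_inl, Sum.elim_comp_inr, sumElim_dotProduct_sumElim, zero_dotProduct,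
    zero_add, mulVec_zero, add_zero]
  exact dotProduct_mulVec_self_eq_zero_of_transpose_eq_neg h21t _

/-- Along an affine path the stretch variance is affine. [folklore] -/
theorem stretchVar_add_smul (G D : Matrix (PhaseIdx n) (PhaseIdx n) ℝ) (s : ℝ) (x : ZMod n) :
    stretchVar (G + s • D) x = stretchVar G x + s * stretchVar D x := by
  simp only [stretchVar, add_mulVec, smul_mulVec, dotProduct_add, dotProduct_smul, smul_eq_mul]

/-- Along an affine path the stretch-velocity variance is affine. [folklore] -/
theorem velVar_add_smul (G D : Matrix (PhaseIdx n) (PhaseIdx n) ℝ) (s : ℝ) (x : ZMod n) :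
    velVar (G + s • D) x = velVar G x + s * velVar D x := by
  simp only [velVar, add_mulVec, smul_mulVec, dotProduct_add, dotProduct_smul, smul_eq_mul]

section Nontrivial

variable [Fact (1 < n)]

/-- `λ₀(G_T) > 0` for `ω₂, T > 0` (`Φ⁻¹` is positive definite and `∇_x ≠ 0`). [folklore] -/
theorem stretchVar_gibbsCov_pos {ω₂ T : ℝ} (hω : 0 < ω₂) (hT : 0 < T) (x : ZMod n) :
    0 < stretchVar (gibbsCov n ω₂ T) x := by
  unfold stretchVar
  rw [gibbsCov_mulVec_stretchCovector]
  unfold stretchCovector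
  rw [sumElim_dotProduct_sumElim, dotProduct_zero, add_zero, dotProduct_smul, smul_eq_mul]
  refine mul_pos hT ?_
  have hpd : ((forceMatrix n ω₂)⁻¹).PosDef := (forceMatrix_posDef hω).inv
  have hne : siteGrad (n := n) x ≠ 0 := by
    intro h
    have := siteGrad_dotProduct_self (n := n) x
    rw [h, dotProduct_zero] at this
    norm_num at this
  simpa using hpd.dotProduct_mulVec_pos hne

/-- The Gibbs up-crossing rate is the same on every bond and positive. [folklore] -/
theorem riceRate_gibbsCov_eq {ω₂ T : ℝ} (x : ZMod n) :
    riceRate (gibbsCov n ω₂ T) x = riceRate (gibbsCov n ω₂ T) 0 := by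
  unfold riceRate
  rw [stretchVar_gibbsCov_eq ω₂ T x, velVar_gibbsCov, velVar_gibbsCov]

/-- The Gibbs up-crossing rate is positive (`ω₂, T > 0`). [folklore] -/
theorem riceRate_gibbsCov_pos {ω₂ T : ℝ} (hω : 0 < ω₂) (hT : 0 < T) (x : ZMod n) :
    0 < riceRate (gibbsCov n ω₂ T) x := by
  unfold riceRate
  have h0 := stretchVar_gibbsCov_pos hω hT x
  have h2 : 0 < velVar (gibbsCov n ω₂ T) x := by rw [velVar_gibbsCov]; positivity
  have : 0 < Real.sqrt (velVar (gibbsCov n ω₂ T) x / stretchVar (gibbsCov n ω₂ T) x) :=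
    Real.sqrt_pos.2 (div_pos h2 h0)
  positivity

/-! ### §2. Calculus along `s ↦ G_T + s δC` -/

omit [Fact (1 < n)] in
/-- Entries of the matrix-vector product along the path are affine in `s`. [folklore] -/
theorem mulVec_add_smul_apply (G D : Matrix (PhaseIdx n) (PhaseIdx n) ℝ) (v : PhaseIdx n → ℝ)
    (s : ℝ) (k : PhaseIdx n) : ((G + s • D) *ᵥ v) k = (G *ᵥ v) k + s * (D *ᵥ v) k := by
  simp only [add_mulVec, smul_mulVec, Pi.add_apply, Pi.smul_apply, smul_eq_mul]

/-- Derivative of an entry of the Palm velocity pattern `w(s) = λ₂(s)⁻¹ C(s)ℓ_ṙ*` at `s = 0`.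
[folklore] -/
theorem hasDerivAt_palmDrift_apply {ω₂ T : ℝ} (hT : 0 < T) (D : Matrix (PhaseIdx n) (PhaseIdx n) ℝ)
    (x : ZMod n) (k : PhaseIdx n) :
    HasDerivAt (fun s : ℝ => palmDrift (gibbsCov n ω₂ T + s • D) x k)
      ((2 * T)⁻¹ * (D *ᵥ velCovector x) k -
        (velVar D x) * T * velCovector x k / (2 * T) ^ 2) 0 := by
  have hform : ∀ s, palmDrift (gibbsCov n ω₂ T + s • D) x k =
      (2 * T + s * velVar D x)⁻¹ * (T * velCovector x k + s * (D *ᵥ velCovector x) k) := by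
    intro s
    simp only [palmDrift, Pi.smul_apply, smul_eq_mul, velVar_add_smul, velVar_gibbsCov,
      mulVec_add_smul_apply, gibbsCov_mulVec_velCovector, Pi.smul_apply]
  simp_rw [hform]
  have h1 : HasDerivAt (fun s : ℝ => 2 * T + s * velVar D x) (velVar D x) 0 := by
    simpa using ((hasDerivAt_id (0 : ℝ)).mul_const (velVar D x)).const_add (2 * T)
  have h1' : HasDerivAt (fun s : ℝ => (2 * T + s * velVar D x)⁻¹)
      (-(velVar D x) / (2 * T + 0 * velVar D x) ^ 2) 0 := h1.inv (by simp; positivity)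
  have h2 : HasDerivAt (fun s : ℝ => T * velCovector x k + s * (D *ᵥ velCovector x) k)
      ((D *ᵥ velCovector x) k) 0 := by
    simpa using ((hasDerivAt_id (0 : ℝ)).mul_const ((D *ᵥ velCovector x) k)).const_add
      (T * velCovector x k)
  have h := h1'.mul h2
  refine h.congr_deriv ?_
  simp only [zero_mul, add_zero]
  field_simp
  ring

/-- Under Gibbs `m = 2w - ℓ_ṙ* = 0`. [folklore] -/
theorem palmM_gibbsCov (ω₂ : ℝ) {T : ℝ} (hT : T ≠ 0) (x : ZMod n) : ((2 : ℝ) • palmDrift (gibbsCov n ω₂ T) x - velCovector x) = 0 := by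
  rw [palmDrift_gibbsCov ω₂ hT x, smul_smul]
  norm_num

/-- **`m' = palmKick`**: the derivative of `m(s) = 2w(s) - ℓ_ṙ*` along `G_T + sδC` at `s = 0` is the
kick mismatch `T⁻¹(δCℓ_ṙ* - ℓ_ṙ*(ℓ_ṙδCℓ_ṙ*)/2)`. [folklore] -/
theorem hasDerivAt_palmM_apply {ω₂ T : ℝ} (hT : 0 < T) (D : Matrix (PhaseIdx n) (PhaseIdx n) ℝ)
    (x : ZMod n) (k : PhaseIdx n) :
    HasDerivAt (fun s : ℝ => ((2 : ℝ) • palmDrift (gibbsCov n ω₂ T + s • D) x - velCovector x) k) (palmKick T x D k) 0 := by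
  have h := ((hasDerivAt_palmDrift_apply (ω₂ := ω₂) hT D x k).const_mul 2).sub_const
    (velCovector x k)
  have hf : (fun s : ℝ => ((2 : ℝ) • palmDrift (gibbsCov n ω₂ T + s • D) x - velCovector x) k) =
      fun s => 2 * palmDrift (gibbsCov n ω₂ T + s • D) x k - velCovector x k := by
    funext s; simp
  rw [hf]
  refine h.congr_deriv ?_
  simp only [palmKick, velVar, Pi.smul_apply, Pi.sub_apply, smul_eq_mul]
  field_simp

/-- Entries of the Palm bump are differentiable along the path (`ω₂, T > 0`). [folklore] -/
theorem differentiableAt_palmBump_apply {ω₂ T : ℝ} (hω : 0 < ω₂) (hT : 0 < T)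
    (D : Matrix (PhaseIdx n) (PhaseIdx n) ℝ) (x : ZMod n) (k : PhaseIdx n) :
    DifferentiableAt ℝ (fun s : ℝ => palmBump (gibbsCov n ω₂ T + s • D) x k) 0 := by
  have hform : (fun s : ℝ => palmBump (gibbsCov n ω₂ T + s • D) x k) = fun s =>
      (stretchVar (gibbsCov n ω₂ T) x + s * stretchVar D x)⁻¹ *
        ((gibbsCov n ω₂ T *ᵥ stretchCovector x) k + s * (D *ᵥ stretchCovector x) k) := by
    funext s
    simp only [palmBump, Pi.smul_apply, smul_eq_mul, stretchVar_add_smul, mulVec_add_smul_apply]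
  rw [hform]
  refine DifferentiableAt.mul (DifferentiableAt.inv (by fun_prop) ?_) (by fun_prop)
  simpa using (stretchVar_gibbsCov_pos hω hT x).ne'

/-- `√(πλ₂(s)/2)` is differentiable at `s = 0` (`λ₂(0) = 2T > 0`). [folklore] -/
theorem differentiableAt_rayleighMean_velVar {ω₂ T : ℝ} (hT : 0 < T)
    (D : Matrix (PhaseIdx n) (PhaseIdx n) ℝ) (x : ZMod n) :
    DifferentiableAt ℝ (fun s : ℝ => rayleighMean (velVar (gibbsCov n ω₂ T + s • D) x)) 0 := by
  have hform : (fun s : ℝ => rayleighMean (velVar (gibbsCov n ω₂ T + s • D) x)) = fun s =>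
      Real.sqrt (Real.pi * (2 * T + s * velVar D x) / 2) := by
    funext s; simp only [rayleighMean, velVar_add_smul, velVar_gibbsCov]
  rw [hform]
  refine DifferentiableAt.sqrt (by fun_prop) ?_
  have : 0 < Real.pi * (2 * T + 0 * velVar D x) / 2 := by simp; positivity
  exact this.ne'

/-- The Rice rate is differentiable along the path at `s = 0` (`ω₂, T > 0`). [folklore] -/
theorem differentiableAt_riceRate {ω₂ T : ℝ} (hω : 0 < ω₂) (hT : 0 < T)
    (D : Matrix (PhaseIdx n) (PhaseIdx n) ℝ) (x : ZMod n) :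
    DifferentiableAt ℝ (fun s : ℝ => riceRate (gibbsCov n ω₂ T + s • D) x) 0 := by
  have h0 := stretchVar_gibbsCov_pos hω hT x
  have hform : (fun s : ℝ => riceRate (gibbsCov n ω₂ T + s • D) x) = fun s =>
      (2 * Real.pi)⁻¹ * Real.sqrt ((2 * T + s * velVar D x) /
        (stretchVar (gibbsCov n ω₂ T) x + s * stretchVar D x)) *
        Real.exp (-(1 / (2 * (stretchVar (gibbsCov n ω₂ T) x + s * stretchVar D x)))) := by
    funext s; simp only [riceRate, velVar_add_smul, velVar_gibbsCov, stretchVar_add_smul]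
  rw [hform]
  have hne : stretchVar (gibbsCov n ω₂ T) x + 0 * stretchVar D x ≠ 0 := by simpa using h0.ne'
  refine DifferentiableAt.mul (DifferentiableAt.mul (by fun_prop) ?_) ?_
  · refine DifferentiableAt.sqrt (DifferentiableAt.div (by fun_prop) (by fun_prop) hne) ?_
    have : 0 < (2 * T + 0 * velVar D x) / (stretchVar (gibbsCov n ω₂ T) x + 0 * stretchVar D x) := by
      simp; positivity
    exact this.ne'
  · refine DifferentiableAt.exp (DifferentiableAt.neg (DifferentiableAt.div (by fun_prop)
      (by fun_prop) ?_))
    simpa using h0.ne'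

/-! ### §3. The derivative of the Palm collision field is `palmMismatchLin` -/

omit [Fact (1 < n)] in
/-- Entrywise structured form of the Palm increment. [folklore] -/
theorem palmMismatchIncrement_apply_eq {C : Matrix (PhaseIdx n) (PhaseIdx n) ℝ} (hCs : Cᵀ = C)
    (x : ZMod n) (h0 : velCovector x ⬝ᵥ C *ᵥ stretchCovector x = 0) (h2 : velVar C x ≠ 0)
    (i j : PhaseIdx n) :
    palmMismatchIncrement C x i j =
      velVar C x * (((2 : ℝ) • palmDrift C x - velCovector x) i * (-velCovector x j) + (-velCovector x i) * ((2 : ℝ) • palmDrift C x - velCovector x) j)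
      + rayleighMean (velVar C x) * (palmBump C x i * ((2 : ℝ) • palmDrift C x - velCovector x) j + ((2 : ℝ) • palmDrift C x - velCovector x) i * palmBump C x j) := by
  rw [palmMismatchIncrement_eq hCs x h0 h2]
  simp only [Matrix.add_apply, Matrix.smul_apply, vecMulVec_apply, Pi.neg_apply, smul_eq_mul]

/-- **The derivative of one bond's Palm increment** along `G_T + sδC` (`δC` flow-invariant symmetric)
is `2(R_xδCR_xᵀ - δC) + √(πT)·palmTilt_x(δC)`, entrywise. [folklore] -/
theorem hasDerivAt_palmMismatchIncrement_apply {ω₂ T : ℝ} (hω : 0 < ω₂) (hT : 0 < T)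
    {D : Matrix (PhaseIdx n) (PhaseIdx n) ℝ} (hD : IsFlowInvariant (flowMatrix n ω₂) D) (hDs : Dᵀ = D)
    (x : ZMod n) (i j : PhaseIdx n) :
    HasDerivAt (fun s : ℝ => palmMismatchIncrement (gibbsCov n ω₂ T + s • D) x i j)
      (((2 : ℝ) • exchangeIncrement x D + rayleighMean (2 * T) • palmTilt n ω₂ T x D) i j) 0 := by
  -- the path is symmetric with `Cov(ṙ, r) = 0` and `λ₂(s) = 2T + s λ₂(δC)`
  have hsym : ∀ s : ℝ, (gibbsCov n ω₂ T + s • D)ᵀ = gibbsCov n ω₂ T + s • D := fun s => by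
    rw [transpose_add, transpose_smul, gibbsCov_transpose, hDs]
  have h0 : ∀ s : ℝ, velCovector x ⬝ᵥ (gibbsCov n ω₂ T + s • D) *ᵥ stretchCovector x = 0 := by
    intro s
    rw [add_mulVec, smul_mulVec, dotProduct_add, dotProduct_smul,
      velCovector_dotProduct_mulVec_stretchCovector_eq_zero (isFlowInvariant_gibbsCov hω T)
        (gibbsCov_transpose ω₂ T),
      velCovector_dotProduct_mulVec_stretchCovector_eq_zero hD hDs, smul_zero, add_zero]
  have hlam : ∀ s : ℝ, velVar (gibbsCov n ω₂ T + s • D) x = 2 * T + s * velVar D x := fun s => by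
    rw [velVar_add_smul, velVar_gibbsCov]
  have hev : ∀ᶠ s in nhds (0 : ℝ), velVar (gibbsCov n ω₂ T + s • D) x ≠ 0 := by
    have hc : ContinuousAt (fun s : ℝ => 2 * T + s * velVar D x) 0 := by fun_prop
    have h1 : (fun s : ℝ => 2 * T + s * velVar D x) 0 ≠ 0 := by simp; positivity
    filter_upwards [hc.eventually_ne h1] with s hs
    rwa [hlam s]
  -- derivatives of the ingredients
  have hm : ∀ k, HasDerivAt (fun s : ℝ => ((2 : ℝ) • palmDrift (gibbsCov n ω₂ T + s • D) x - velCovector x) k) (palmKick T x D k) 0 :=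
    fun k => hasDerivAt_palmM_apply hT D x k
  have hm0 : ∀ k, ((2 : ℝ) • palmDrift (gibbsCov n ω₂ T + (0 : ℝ) • D) x - velCovector x) k = 0 := fun k => by
    rw [zero_smul, add_zero, palmM_gibbsCov ω₂ hT.ne' x]; rfl
  have hu : ∀ k, HasDerivAt (fun s : ℝ => palmBump (gibbsCov n ω₂ T + s • D) x k)
      (deriv (fun s : ℝ => palmBump (gibbsCov n ω₂ T + s • D) x k) 0) 0 :=
    fun k => (differentiableAt_palmBump_apply hω hT D x k).hasDerivAt
  have hmu : HasDerivAt (fun s : ℝ => rayleighMean (velVar (gibbsCov n ω₂ T + s • D) x))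
      (deriv (fun s : ℝ => rayleighMean (velVar (gibbsCov n ω₂ T + s • D) x)) 0) 0 :=
    (differentiableAt_rayleighMean_velVar hT D x).hasDerivAt
  have hlamD : HasDerivAt (fun s : ℝ => velVar (gibbsCov n ω₂ T + s • D) x) (velVar D x) 0 := by
    have : (fun s : ℝ => velVar (gibbsCov n ω₂ T + s • D) x) = fun s => 2 * T + s * velVar D x :=
      funext hlam
    rw [this]
    simpa using ((hasDerivAt_id (0 : ℝ)).mul_const (velVar D x)).const_add (2 * T)
  -- the two brackets
  have hA : HasDerivAt (fun s : ℝ => ((2 : ℝ) • palmDrift (gibbsCov n ω₂ T + s • D) x - velCovector x) i * (-velCovector x j) +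
      (-velCovector x i) * ((2 : ℝ) • palmDrift (gibbsCov n ω₂ T + s • D) x - velCovector x) j)
      (palmKick T x D i * (-velCovector x j) + (-velCovector x i) * palmKick T x D j) 0 :=
    ((hm i).mul_const (-velCovector x j)).add ((hm j).const_mul (-velCovector x i))
  have hB : HasDerivAt (fun s : ℝ => palmBump (gibbsCov n ω₂ T + s • D) x i *
      ((2 : ℝ) • palmDrift (gibbsCov n ω₂ T + s • D) x - velCovector x) j +
      ((2 : ℝ) • palmDrift (gibbsCov n ω₂ T + s • D) x - velCovector x) i * palmBump (gibbsCov n ω₂ T + s • D) x j)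
      (palmBump (gibbsCov n ω₂ T) x i * palmKick T x D j +
        palmKick T x D i * palmBump (gibbsCov n ω₂ T) x j) 0 := by
    have := ((hu i).mul (hm j)).add ((hm i).mul (hu j))
    refine this.congr_deriv ?_
    rw [hm0, hm0, zero_smul, add_zero]
    ring
  have hF : HasDerivAt (fun s : ℝ =>
      velVar (gibbsCov n ω₂ T + s • D) x * (((2 : ℝ) • palmDrift (gibbsCov n ω₂ T + s • D) x - velCovector x) i * (-velCovector x j) +
        (-velCovector x i) * ((2 : ℝ) • palmDrift (gibbsCov n ω₂ T + s • D) x - velCovector x) j) +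
      rayleighMean (velVar (gibbsCov n ω₂ T + s • D) x) *
        (palmBump (gibbsCov n ω₂ T + s • D) x i * ((2 : ℝ) • palmDrift (gibbsCov n ω₂ T + s • D) x - velCovector x) j +
          ((2 : ℝ) • palmDrift (gibbsCov n ω₂ T + s • D) x - velCovector x) i * palmBump (gibbsCov n ω₂ T + s • D) x j))
      ((2 * T) * (palmKick T x D i * (-velCovector x j) + (-velCovector x i) * palmKick T x D j) +
        rayleighMean (2 * T) * (palmBump (gibbsCov n ω₂ T) x i * palmKick T x D j +
          palmKick T x D i * palmBump (gibbsCov n ω₂ T) x j)) 0 := by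
    have := (hlamD.mul hA).add (hmu.mul hB)
    refine this.congr_deriv ?_
    rw [hm0, hm0, hlam 0]
    simp only [zero_mul, mul_zero, add_zero, zero_add]
  -- transfer to the entry of the increment
  have heq : (fun s : ℝ => palmMismatchIncrement (gibbsCov n ω₂ T + s • D) x i j) =ᶠ[nhds 0]
      (fun s : ℝ =>
        velVar (gibbsCov n ω₂ T + s • D) x * (((2 : ℝ) • palmDrift (gibbsCov n ω₂ T + s • D) x - velCovector x) i * (-velCovector x j) +
          (-velCovector x i) * ((2 : ℝ) • palmDrift (gibbsCov n ω₂ T + s • D) x - velCovector x) j) +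
        rayleighMean (velVar (gibbsCov n ω₂ T + s • D) x) *
          (palmBump (gibbsCov n ω₂ T + s • D) x i * ((2 : ℝ) • palmDrift (gibbsCov n ω₂ T + s • D) x - velCovector x) j +
            ((2 : ℝ) • palmDrift (gibbsCov n ω₂ T + s • D) x - velCovector x) i * palmBump (gibbsCov n ω₂ T + s • D) x j)) := by
    filter_upwards [hev] with s hs
    exact palmMismatchIncrement_apply_eq (hsym s) x (h0 s) hs i j
  refine (hF.congr_of_eventuallyEq heq).congr_deriv ?_
  rw [Matrix.add_apply, Matrix.smul_apply, Matrix.smul_apply,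
    exchangeIncrement_eq_smul_vecMulVec hT.ne' x hDs, Matrix.smul_apply]
  simp only [palmTilt, Matrix.add_apply, vecMulVec_apply, Pi.neg_apply, smul_eq_mul]
  ring

/-- **THE LINEARISED FIELD IS THE DERIVATIVE OF THE PALM COLLISION FIELD.** For `ω₂, T > 0` and a
flow-invariant symmetric direction `δC`, every entry of `s ↦ 𝒩_T(G_T + sδC)` is differentiable at
`s = 0` with derivative the corresponding entry of `palmMismatchLin δC`: the Rice-weight derivatives
multiply `Δ_x(G_T) = 0`, the Rayleigh-mean and bump derivatives multiply `m(G_T) = 0`, and what is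
left is `Σ_x [2(R_xδCR_xᵀ - δC) + √(πT)(u_x m'ᵀ + m' u_xᵀ)]`. [folklore] -/
theorem hasDerivAt_palmCollisionField_apply {ω₂ T : ℝ} (hω : 0 < ω₂) (hT : 0 < T)
    {D : Matrix (PhaseIdx n) (PhaseIdx n) ℝ} (hD : IsFlowInvariant (flowMatrix n ω₂) D) (hDs : Dᵀ = D)
    (i j : PhaseIdx n) :
    HasDerivAt (fun s : ℝ => palmCollisionField n ω₂ T (gibbsCov n ω₂ T + s • D) i j)
      (palmMismatchLin n ω₂ T D i j) 0 := by
  have hν0 : 2 * riceRate (gibbsCov n ω₂ T) 0 ≠ 0 :=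
    mul_ne_zero two_ne_zero (riceRate_gibbsCov_pos hω hT 0).ne'
  have hform : (fun s : ℝ => palmCollisionField n ω₂ T (gibbsCov n ω₂ T + s • D) i j) = fun s =>
      (2 * riceRate (gibbsCov n ω₂ T) 0)⁻¹ * ∑ x : ZMod n,
        (2 * riceRate (gibbsCov n ω₂ T + s • D) x) *
          palmMismatchIncrement (gibbsCov n ω₂ T + s • D) x i j := by
    funext s
    simp only [palmCollisionField, Matrix.smul_apply, Matrix.sum_apply, smul_eq_mul]
  rw [hform]
  have hx : ∀ x ∈ (Finset.univ : Finset (ZMod n)), HasDerivAt (fun s : ℝ =>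
      (2 * riceRate (gibbsCov n ω₂ T + s • D) x) * palmMismatchIncrement (gibbsCov n ω₂ T + s • D) x i j)
      ((2 * riceRate (gibbsCov n ω₂ T) 0) *
        (((2 : ℝ) • exchangeIncrement x D + rayleighMean (2 * T) • palmTilt n ω₂ T x D) i j)) 0 := by
    intro x _
    have hν := ((differentiableAt_riceRate hω hT D x).hasDerivAt).const_mul 2
    have := hν.mul (hasDerivAt_palmMismatchIncrement_apply hω hT hD hDs x i j)
    refine this.congr_deriv ?_
    rw [zero_smul, add_zero, palmMismatchIncrement_gibbsCov ω₂ hT.ne' x, riceRate_gibbsCov_eq x]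
    simp
  have hsum := (HasDerivAt.fun_sum hx).const_mul ((2 * riceRate (gibbsCov n ω₂ T) 0)⁻¹)
  refine hsum.congr_deriv ?_
  rw [← Finset.mul_sum, ← mul_assoc, inv_mul_cancel₀ hν0, one_mul]
  simp only [palmMismatchLin, Matrix.sum_apply]

end Nontrivial

end Literature.MathematicalPhysics.KineticTheory.PalmMismatch
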